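import Summits.BirchSwinnertonDyer.BirchSwinnertonDyer.Theorems.ClassRecordThreeEulerHalvesAtThreeSection6Joined
import Summits.BirchSwinnertonDyer.BirchSwinnertonDyer.Theorems.ClassRecordThreeEulerHalvesAtThreeWalkConductors
import Summits.BirchSwinnertonDyer.BirchSwinnertonDyer.Theorems.ClassRecordThreeEulerHalvesAtThreeWalkStructures
import Summits.BirchSwinnertonDyer.BirchSwinnertonDyer.Theorems.KolyvaginRoadThreeMethod2Step
import Summits.BirchSwinnertonDyer.Rank1Residual.X11b.Three.KolyvaginLine
import HarnessLib

/-!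
# The Jetchev WALK on the row objects: the kernel §6 (Prop. 6.4 ∘ Thm. 6.3, joined form
# `JET.Section6.tamagawaExponent_le_m_of_selmerFamilies`) INSTANTIATED on `H¹(K, E[p^k])` —
# `ord_p c_q ≤ m(c)` from NAMED inputs in concrete currency (cell `bsd-stepL`, seat `bsd-stepL-tam3-p1`,
# helper toward item 19109 `EulerHalvesAtThree`, registered stub `stub_jetchevMaxHLAtThree`)

HONEST FRAMING. Nothing here proves BSD, J₃ or the divisibility of any Heegner point; the registered
stub is NOT discharged — this theorem has hypothesis-shaped binders that nothing in the tree supplies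
yet; no item closes; 0 classes move (T7); `--supports stmt-BirchSwinnertonDyer-19109` (helper).
WHAT THIS FILE DOES. The clause `hlev` of `Koly.jetchevMaxHLAtThree_of_facts_of_perLevel` (p490155) is
the conclusion of the abstract walk (p484791: Prop. 6.4 by the potential argument, p484455, then
Thm. 6.3 at the half-core vertex) once its families are instantiated; this file IS that instantiation,
for any odd `p` with the `p`-adic tower, `K` imaginary quadratic (`d_K ∉ {−3,−4}`, Heegner), complex
conjugation `τ`, level `p^k`, square-free base conductor `c` of Kolyvagin primes, `m(c) < k`,
`k + m(c) ≤ M(c)`. DICTIONARY (tree objects only): `G := H¹(K,E[p^k])`; `P :=` Kolyvagin primes `ℓ ∤ c`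
(Zhang, `N = N_E`) of index `≥ k + m(c)`; conductors `c·∏ n`; `λ(ℓ) := (ℓ)`; `loc :=`
`galoisCohomology.localization` at `λ`; `Hf :=` Kummer at `λ`, `Htr := 𝒯_λ` (transverse family `𝒯` a
PARAMETER, as in bsd-jet's `Jetchev2008.selmerF`); `Gs ± := signPart τ (±1) ⊤`;
`Sel n ± := signPart (selmerF W p^k 𝒯 (placesDividing K (c∏n))).selmerGroup`, `Rel n ℓ ±` the same
relaxed at `λ(ℓ)`; `e n := ε(c∏n)` (sign function `eb`, `ε(mℓ) = −ε(m)`); `M := Zhang2014.levelIndex`,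
`mdiv := Koly.divOrd`, `mc :=` McCallum's `m`; `κ n := (D (c∏n)).kolyvaginClass p k` for a DATA SYSTEM
`D : ∀ m, KolyvaginHeegnerData Dt β ι m`; block 2 at the carrier places `Qcar` (over `q ∣ N`):
`B' := (H_{𝓕₀})^{−ε}` via `selmerF0` (stringent family `𝒮 ≤` Kummer, PARAMETER), `C' :=` dual
modules (PARAMETER), `D' n ℓ := (H_{𝓕₀^λ})^{−ε}`. DISCHARGED HERE: `hSel`/`hSelT` (`…WalkStructures`,
p494241), `hSelGs`, `he`, `hm`, `hM`, `h0`, admissibility of every `c∏n` and the carrier/Kolyvagin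
place bookkeeping (`…WalkConductors`), **`h61` = Lemma 6.1 decoupled, KERNEL** (`…WalkCebotarev`,
p494064), `h47` (typed McCallum Prop. 4.4 via bsd-jet's
`JET.addOrderOf_localization_kolyvaginClass_mul_eq_of_prop44`), `hB'A'`, finiteness transfer, the
choice/totalisation of block 2. NAMED HYPOTHESES LEFT (same objects as bsd-jet pv-2's
`JET.tamagawaExponent_le_mInfty_of_rowData`, at EVERY admissible multiple of `c`): `hdisj` ([J] §4.2),
`hfin`, `hPT` (Thm. 5.1 ∕ Lemma 5.2 (iii) per sign at `λ`), `hκt` (S7♯, §3.1 item 7), `hordκ` (S7,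
§3.1 items 4–5), `hdata` (Prop. 4.4's compatibilities), `hC`, `hdual_q` (Thm. 5.1 at `q` + (δ)), `h49`
(Prop. 4.9), `hdual_ℓ` (Lemma 5.2 (iii) at `λ` for `𝓕₀`), and the typed PRINT fact `h44`. CONCLUSION:
`(t : ℕ∞) ≤ m(c)` — the `hlev` clause at `(k, c, D c)` with `t = ord_p c_q`; no reading binder (K5),
no abstract data left. References (locators only; no cited FACT declared): [cite: Jetchev2008, §3.1,
§4.2–4.3, Prop. 4.7, Prop. 4.9, Thm. 5.1, Lemma 5.2, Lemma 6.1, Thm. 6.3, Prop. 6.4, Proof of Thm. 1.4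
(pp. 816–825)] [cite: McCallumLMS1991, §3 Cor. 3.2, §4 Prop. 4.4, §5] [cite: WZhang2014, Notations (xii)].
Design: one theorem, no definitions; `K : Type`. Axioms: `propext`, `Classical.choice`, `Quot.sound`.
-/

set_option autoImplicit false

noncomputable section

open scoped Classical NumberField

namespace Summit.BirchSwinnertonDyer.Rank1Residual.X11b.Three.Koly

open WeierstrassCurve IsDedekindDomain NumberField Literature.NumberTheory.EllipticCurves
  Literature.NumberTheory.EllipticCurves.ModularForms Literature.NumberTheory.EllipticCurves.Jetchev2008
  Literature.NumberTheory.GaloisRepresentations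
  Literature.NumberTheory.GaloisRepresentations.DiscreteGaloisModule
  Summit.BirchSwinnertonDyer.Rank1Residual.JET

/-- **The kernel §6 walk ([J] Prop. 6.4 ∘ Thm. 6.3) on the row objects: `ord_p c_q ≤ m(c)`** — see the
module docstring for the dictionary, for the inputs discharged here (`hSel`, `hSelT`, `hSelGs`, `he`,
`hm`, `hM`, `h0`, `h61` kernel, `h47` from Prop. 4.4, `hB'A'`) and for the NAMED hypotheses left
(`hdisj`, `hfin`, `hPT`, `hκt`, `hordκ`, `hdata`, `hC`, `hdual_q`, `h49`, `hdual_ℓ`, the typed `h44`).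
CONCLUSION: `(t : ℕ∞) ≤ m(c)` (McCallum's `m`: `ord_p P_c` if `< M(c)`, else `∞`), i.e. the `hlev`
clause of `Koly.jetchevMaxHLAtThree_of_facts_of_perLevel` at `(k, c, D c)`.
[cite: Jetchev2008, Prop. 6.4, Thm. 6.3, Proof of Thm. 1.4 (pp. 822–825)] [cite: McCallumLMS1991, §3 Cor. 3.2, §4 Prop. 4.4] -/
theorem tamagawaExponent_le_m_of_rowFamilies
    (W : WeierstrassCurve ℚ) [W.IsElliptic] [W.IsGloballyMinimal] [NeZero (W.conductorNorm ℤ)]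
    (hcm : ¬ W.HasCM) (K : Type) [Field K] [NumberField K] (hK : IsImaginaryQuadratic K)
    (hD3 : NumberField.discr K ≠ -3) (hD4 : NumberField.discr K ≠ -4)
    (hH : SatisfiesHeegnerHypothesis (W.conductorNorm ℤ) K)
    (p : ℕ) [Fact p.Prime] (hp2 : p ≠ 2) (htower : ∀ n : ℕ, W.HasSurjectiveModNGaloisRep (p ^ n : ℕ))
    (Dt : ModularParametrizationData W (W.conductorNorm ℤ)) (β : ℤ) (ι : K →+* ℂ)
    [∀ j : ℕ, NumberField (ringClassField K ι j)] (τ : K ≃ₐ[ℚ] K) (hτ : τ ≠ 1)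
    (h44 : McCallum1991.prop44_localOrder_kolyvaginClass_mul_eq) (k t : ℕ) (hk : 1 ≤ k) (htk : t ≤ k)
    (𝒯 𝒮 : SelmerStructure ((W.baseChange K).torsionGaloisModule ((p ^ k : ℕ) : ℤ)))
    (hS : ∀ v, 𝒮 v ≤ (W.baseChange K).kummerSelmerStructure ((p ^ k : ℕ) : ℤ) v)
    (Qcar : Finset (HeightOneSpectrum (𝓞 K)))
    (hQcar : ∀ v ∈ Qcar, ((W.conductorNorm ℤ : ℕ) : 𝓞 K) ∈ v.asIdeal)
    (D : ∀ m : ℕ, KolyvaginHeegnerData Dt β ι m) (eb : ℕ → Bool)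
    (heb : ∀ (m ℓ : ℕ), ℓ.Prime → ¬ ℓ ∣ m → eb (m * ℓ) = !eb m)
    (c : ℕ) (hc : Squarefree c)
    (hcK : ∀ q ∈ c.primeFactors, Zhang2014.IsKolyvaginPrime (W.conductorNorm ℤ) W K p q)
    (h0 : (if divOrd (D c) p < Zhang2014.levelIndex W p c then divOrd (D c) p else (⊤ : ℕ∞)) < (k : ℕ∞))
    (hMc : (k : ℕ∞) + (if divOrd (D c) p < Zhang2014.levelIndex W p c then divOrd (D c) p else ⊤) ≤
      Zhang2014.levelIndex W p c)
    (hdisj : ∀ (ℓ : ℕ), Zhang2014.IsKolyvaginPrime (W.conductorNorm ℤ) W K p ℓ →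
      k ≤ Zhang2014.kolyvaginIndex W p ℓ → ∀ v : HeightOneSpectrum (𝓞 K), (ℓ : 𝓞 K) ∈ v.asIdeal →
      Disjoint ((W.baseChange K).kummerSelmerStructure ((p ^ k : ℕ) : ℤ) (Sum.inr v)) (𝒯 (Sum.inr v)))
    (hfin : ∀ (m : ℕ) (v : HeightOneSpectrum (𝓞 K)),
      Finite ((selmerF W ((p ^ k : ℕ) : ℤ) 𝒯 (placesDividing K m)).relaxedAt {v}).selmerGroup)
    (hPT : ∀ (m : ℕ), c ∣ m → Squarefree m →
      (∀ q ∈ m.primeFactors, Zhang2014.IsKolyvaginPrime (W.conductorNorm ℤ) W K p q ∧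
        k ≤ Zhang2014.kolyvaginIndex W p q) →
      ∀ (ℓ : ℕ), Zhang2014.IsKolyvaginPrime (W.conductorNorm ℤ) W K p ℓ →
      k ≤ Zhang2014.kolyvaginIndex W p ℓ → ¬ ℓ ∣ m →
      ∀ v : HeightOneSpectrum (𝓞 K), (ℓ : 𝓞 K) ∈ v.asIdeal → ∀ s : Bool,
      Nat.card ((signPart W K τ ((p ^ k : ℕ) : ℤ) (if s then 1 else -1)
          ((selmerF W ((p ^ k : ℕ) : ℤ) 𝒯 (placesDividing K m)).relaxedAt {v}).selmerGroup).map
        (galoisCohomology.localization ((W.baseChange K).torsionGaloisModule ((p ^ k : ℕ) : ℤ))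
          (Sum.inr v) 1)) = p ^ k)
    (hκt : ∀ (m : ℕ), c ∣ m → Squarefree m →
      (∀ q ∈ m.primeFactors, Zhang2014.IsKolyvaginPrime (W.conductorNorm ℤ) W K p q ∧
        k ≤ Zhang2014.kolyvaginIndex W p q) →
      (if divOrd (D m) p < Zhang2014.levelIndex W p m then divOrd (D m) p else (⊤ : ℕ∞)) + (k : ℕ∞) ≤
        Zhang2014.levelIndex W p m →
      ∃ x : galoisCohomology ((W.baseChange K).torsionGaloisModule ((p ^ k : ℕ) : ℤ)) 1,
        x ∈ signPart W K τ ((p ^ k : ℕ) : ℤ) (if eb m then 1 else -1)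
          (selmerF W ((p ^ k : ℕ) : ℤ) 𝒯 (placesDividing K m)).selmerGroup ∧
        addOrderOf x = p ^ k ∧
        ((D m).kolyvaginClass (Fact.out : p.Prime) k :
            galoisCohomology ((W.baseChange K).torsionGaloisModule ((p ^ k : ℕ) : ℤ)) 1) =
          p ^ (if divOrd (D m) p < Zhang2014.levelIndex W p m then divOrd (D m) p else (⊤ : ℕ∞)).toNat • x)
    (hordκ : ∀ (m : ℕ), c ∣ m → Squarefree m →
      (∀ q ∈ m.primeFactors, Zhang2014.IsKolyvaginPrime (W.conductorNorm ℤ) W K p q ∧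
        k ≤ Zhang2014.kolyvaginIndex W p q) →
      ∀ j : ℕ, j < k →
        p ^ (k - j) ∣ addOrderOf ((D m).kolyvaginClass (Fact.out : p.Prime) k :
          galoisCohomology ((W.baseChange K).torsionGaloisModule ((p ^ k : ℕ) : ℤ)) 1) →
        divOrd (D m) p ≤ (j : ℕ∞))
    (hdata : ∀ (m ℓ : ℕ), c ∣ m → Squarefree (m * ℓ) → ℓ.Prime → ¬ ℓ ∣ m →
      (∀ l' ∈ m.primeFactors, ∀ (x : ringClassField K ι m) (x' : ringClassField K ι (m * ℓ)),
        (x : ℂ) = x' → (((D (m * ℓ)).σ l' x' : ringClassField K ι (m * ℓ)) : ℂ) = ((D m).σ l' x : ℂ)) ∧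
      (∀ s ∈ (D m).S, ∃ s' ∈ (D (m * ℓ)).S, ∀ (x : ringClassField K ι m) (x' : ringClassField K ι (m * ℓ)),
        (x : ℂ) = x' → ((s' x' : ringClassField K ι (m * ℓ)) : ℂ) = (s x : ℂ)) ∧
      (∀ s' ∈ (D (m * ℓ)).S, ∃ s ∈ (D m).S, ∀ (x : ringClassField K ι m) (x' : ringClassField K ι (m * ℓ)),
        (x : ℂ) = x' → ((s' x' : ringClassField K ι (m * ℓ)) : ℂ) = (s x : ℂ)) ∧
      (∀ (x : ringClassField K ι m) (x' : ringClassField K ι (m * ℓ)),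
        (x : ℂ) = x' → (D (m * ℓ)).emb x' = (D m).emb x))
    (C' : ℕ → AddSubgroup (galoisCohomology ((W.baseChange K).torsionGaloisModule ((p ^ k : ℕ) : ℤ)) 1))
    (hC : ∀ m, C' m ≤ signPart W K τ ((p ^ k : ℕ) : ℤ) (if !eb m then 1 else -1) ⊤)
    (hdual_q : ∀ (m : ℕ), c ∣ m → Squarefree m →
      (∀ q ∈ m.primeFactors, Zhang2014.IsKolyvaginPrime (W.conductorNorm ℤ) W K p q ∧
        k ≤ Zhang2014.kolyvaginIndex W p q) →
      ∃ (Qg Qg' : Type) (_ : AddCommGroup Qg) (_ : AddCommGroup Qg') (_ : Finite Qg')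
        (locq : signPart W K τ ((p ^ k : ℕ) : ℤ) (if !eb m then 1 else -1)
            (selmerF W ((p ^ k : ℕ) : ℤ) 𝒯 (placesDividing K m)).selmerGroup →+ Qg)
        (locq' : C' m →+ Qg'),
        (∀ x : C' m, locq' x = 0 ↔
          (x : galoisCohomology ((W.baseChange K).torsionGaloisModule ((p ^ k : ℕ) : ℤ)) 1) ∈
            signPart W K τ ((p ^ k : ℕ) : ℤ) (if !eb m then 1 else -1)
              (selmerF W ((p ^ k : ℕ) : ℤ) 𝒯 (placesDividing K m)).selmerGroup) ∧
        Nat.card locq.range * Nat.card locq'.range = Nat.card Qg' ∧ IsAddCyclic Qg' ∧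
        Nat.card Qg' = p ^ t)
    (h49 : ∀ (m ℓ : ℕ), c ∣ m → Squarefree m →
      (∀ q ∈ m.primeFactors, Zhang2014.IsKolyvaginPrime (W.conductorNorm ℤ) W K p q ∧
        k ≤ Zhang2014.kolyvaginIndex W p q) →
      Zhang2014.IsKolyvaginPrime (W.conductorNorm ℤ) W K p ℓ → k ≤ Zhang2014.kolyvaginIndex W p ℓ →
      ¬ ℓ ∣ m → ∀ v : HeightOneSpectrum (𝓞 K), (ℓ : 𝓞 K) ∈ v.asIdeal →
      ((D (m * ℓ)).kolyvaginClass (Fact.out : p.Prime) k :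
          galoisCohomology ((W.baseChange K).torsionGaloisModule ((p ^ k : ℕ) : ℤ)) 1) ∈
        signPart W K τ ((p ^ k : ℕ) : ℤ) (if !eb m then 1 else -1)
          (((selmerF0 W ((p ^ k : ℕ) : ℤ) 𝒯 𝒮 (placesDividing K m) Qcar).relaxedAt {v}).selmerGroup))
    (hdual_ℓ : ∀ (m ℓ : ℕ), c ∣ m → Squarefree m →
      (∀ q ∈ m.primeFactors, Zhang2014.IsKolyvaginPrime (W.conductorNorm ℤ) W K p q ∧
        k ≤ Zhang2014.kolyvaginIndex W p q) →
      Zhang2014.IsKolyvaginPrime (W.conductorNorm ℤ) W K p ℓ → k ≤ Zhang2014.kolyvaginIndex W p ℓ →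
      ¬ ℓ ∣ m → ∀ v : HeightOneSpectrum (𝓞 K), (ℓ : 𝓞 K) ∈ v.asIdeal →
      ∃ (Sg : Type) (_ : AddCommGroup Sg)
        (sing : signPart W K τ ((p ^ k : ℕ) : ℤ) (if !eb m then 1 else -1)
            (((selmerF0 W ((p ^ k : ℕ) : ℤ) 𝒯 𝒮 (placesDividing K m) Qcar).relaxedAt {v}).selmerGroup) →+ Sg),
        (∀ x, sing x = 0 ↔
          (x : galoisCohomology ((W.baseChange K).torsionGaloisModule ((p ^ k : ℕ) : ℤ)) 1) ∈
            signPart W K τ ((p ^ k : ℕ) : ℤ) (if !eb m then 1 else -1)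
              ((selmerF0 W ((p ^ k : ℕ) : ℤ) 𝒯 𝒮 (placesDividing K m) Qcar).selmerGroup)) ∧
        Nat.card sing.range *
          Nat.card ((C' m).map (galoisCohomology.localization
            ((W.baseChange K).torsionGaloisModule ((p ^ k : ℕ) : ℤ)) (Sum.inr v) 1)) = p ^ k) :
    (t : ℕ∞) ≤ (if divOrd (D c) p < Zhang2014.levelIndex W p c then divOrd (D c) p else ⊤) := by
  have hp : p.Prime := Fact.out
  have hc0 : c ≠ 0 := hc.ne_zero
  have hρ : W.HasSurjectiveModNGaloisRep p := by simpa using htower 1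
  -- ### `u := m(c)` as a natural number
  set mcc : ℕ∞ := (if divOrd (D c) p < Zhang2014.levelIndex W p c then divOrd (D c) p else (⊤ : ℕ∞))
    with hmcc_def
  have hmcc_ne : mcc ≠ ⊤ := ne_top_of_lt h0
  set u : ℕ := mcc.toNat with hu
  have hmcu : mcc = (u : ℕ∞) := (ENat.coe_toNat hmcc_ne).symm
  have hku : ((k + u : ℕ) : ℕ∞) = (k : ℕ∞) + mcc := by rw [hmcu]; push_cast; rfl
  have hcidx : ∀ q ∈ c.primeFactors, k + u ≤ Zhang2014.kolyvaginIndex W p q :=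
    Zhang2014.natCast_le_levelIndex_iff.mp (hku ▸ hMc)
  -- ### the pool of primes `P` and the place `λ(ℓ)`
  let P : Type := {ℓ : ℕ // Zhang2014.IsKolyvaginPrime (W.conductorNorm ℤ) W K p ℓ ∧
    k + u ≤ Zhang2014.kolyvaginIndex W p ℓ ∧ ¬ ℓ ∣ c}
  have hPprime : ∀ ℓ : P, (ℓ : ℕ).Prime := fun ℓ ↦ ℓ.2.1.1
  have hPk : ∀ ℓ : P, k ≤ Zhang2014.kolyvaginIndex W p ℓ := fun ℓ ↦ le_trans (Nat.le_add_right k u) ℓ.2.2.1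
  let lam : P → HeightOneSpectrum (𝓞 K) := fun ℓ ↦
    ⟨Ideal.span {((ℓ : ℕ) : 𝓞 K)}, ℓ.2.1.2.2.2.2.1, by
      rw [Ne, Ideal.span_singleton_eq_bot]
      exact_mod_cast (hPprime ℓ).ne_zero⟩
  have hlam_mem : ∀ ℓ : P, ((ℓ : ℕ) : 𝓞 K) ∈ (lam ℓ).asIdeal := fun ℓ ↦ Ideal.mem_span_singleton_self _
  -- ### the conductors `c·∏ n` (an opaque function with its specification)
  obtain ⟨cond, hcond⟩ : ∃ cond : Finset P → ℕ, ∀ n, cond n = c * ∏ ℓ ∈ n, (ℓ : ℕ) :=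
    ⟨_, fun _ ↦ rfl⟩
  have hcond_empty : cond ∅ = c := by rw [hcond, Finset.prod_empty, mul_one]
  have hcond_insert : ∀ (n : Finset P) (ℓ : P), ℓ ∉ n → cond (insert ℓ n) = cond n * ℓ := by
    intro n ℓ hℓ
    rw [hcond, hcond, Finset.prod_insert hℓ]
    ring
  -- admissibility of every conductor of the walk
  have hadm : ∀ n : Finset P, c ∣ cond n ∧ Squarefree (cond n) ∧
      (∀ q ∈ (cond n).primeFactors, Zhang2014.IsKolyvaginPrime (W.conductorNorm ℤ) W K p q ∧
        k + u ≤ Zhang2014.kolyvaginIndex W p q) ∧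
      (∀ ℓ : P, ℓ ∉ n → ¬ (ℓ : ℕ) ∣ cond n) := by
    intro n
    obtain ⟨hsq, hfac, hnd⟩ := Walk.squarefree_mul_prod_facts (fun ℓ : P ↦ (ℓ : ℕ))
      Subtype.val_injective hPprime hc (fun ℓ ↦ ℓ.2.2.2) n
    rw [hcond]
    refine ⟨Dvd.intro _ rfl, hsq, fun q hq ↦ ?_, hnd⟩
    rw [hfac, Finset.mem_union, Finset.mem_image] at hq
    rcases hq with hq | ⟨ℓ, -, rfl⟩
    · exact ⟨hcK q hq, hcidx q hq⟩
    · exact ⟨ℓ.2.1, ℓ.2.2.1⟩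
  have hadmk : ∀ n : Finset P, ∀ q ∈ (cond n).primeFactors,
      Zhang2014.IsKolyvaginPrime (W.conductorNorm ℤ) W K p q ∧ k ≤ Zhang2014.kolyvaginIndex W p q :=
    fun n q hq ↦ ⟨((hadm n).2.2.1 q hq).1, le_trans (Nat.le_add_right k u) ((hadm n).2.2.1 q hq).2⟩
  have hcond0 : ∀ n : Finset P, cond n ≠ 0 := fun n ↦ (hadm n).2.1.ne_zero
  have hMn : ∀ n : Finset P, (k : ℕ∞) + mcc ≤ Zhang2014.levelIndex W p (cond n) := fun n ↦ by
    rw [← hku]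
    exact Zhang2014.natCast_le_levelIndex_iff.mpr fun q hq ↦ ((hadm n).2.2.1 q hq).2
  -- places: `λ ∉ placesDividing (cond n)` for `ℓ ∉ n`, and the insertion rule
  have hlam_not : ∀ (n : Finset P) (ℓ : P), ℓ ∉ n → lam ℓ ∉ placesDividing K (cond n) :=
    fun n ℓ hℓ ↦ Walk.not_mem_placesDividing_of_not_dvd (hPprime ℓ) (hlam_mem ℓ) ((hadm n).2.2.2 ℓ hℓ)
  have hplaces_insert : ∀ (n : Finset P) (ℓ : P), ℓ ∉ n →
      placesDividing K (cond (insert ℓ n)) = insert (lam ℓ) (placesDividing K (cond n)) := by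
    intro n ℓ hℓ
    rw [hcond_insert n ℓ hℓ]
    exact Walk.placesDividing_mul_eq_insert (hcond0 n) (hPprime ℓ) ℓ.2.1.2.2.2.2.1 (hlam_mem ℓ)
  -- the carrier places avoid the places dividing the conductors
  have hQnot : ∀ (n : Finset P), ∀ v ∈ Qcar, v ∉ placesDividing K (cond n) := by
    intro n v hv hmem
    rw [SelmerVocabulary.mem_placesDividing_iff_natCast_mem (hcond0 n),
      SelmerVocabulary.natCast_mem_iff_exists_primeFactor_mem (hcond0 n)] at hmem
    obtain ⟨q, hq, hqv⟩ := hmem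
    have hqK := ((hadm n).2.2.1 q hq).1
    exact Method2.not_mem_asIdeal_of_coprime (K := K) ((Nat.Prime.coprime_iff_not_dvd hqK.1).mpr hqK.2.1) v hqv
      (hQcar v hv)
  -- ### block 2: Thm 5.1 at the carrier, per conductor (choice)
  choose Qg Qg' instQ instQ' instFin locq locq' hker horth_q hQcyc hQcard using
    fun n : Finset P ↦ hdual_q (cond n) (hadm n).1 (hadm n).2.1 (hadmk n)
  -- ### block 2: duality at `λ`, per (conductor, prime) — totalised in `ℓ`
  have hdl : ∀ (n : Finset P) (ℓ : P), ∃ (Sg : Type) (_ : AddCommGroup Sg)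
      (sing : signPart W K τ ((p ^ k : ℕ) : ℤ) (if !eb (cond n) then 1 else -1)
          (((selmerF0 W ((p ^ k : ℕ) : ℤ) 𝒯 𝒮 (placesDividing K (cond n)) Qcar).relaxedAt
            {lam ℓ}).selmerGroup) →+ Sg),
      ℓ ∉ n →
        ((∀ x, sing x = 0 ↔
          (x : galoisCohomology ((W.baseChange K).torsionGaloisModule ((p ^ k : ℕ) : ℤ)) 1) ∈
            signPart W K τ ((p ^ k : ℕ) : ℤ) (if !eb (cond n) then 1 else -1)
              ((selmerF0 W ((p ^ k : ℕ) : ℤ) 𝒯 𝒮 (placesDividing K (cond n)) Qcar).selmerGroup)) ∧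
        Nat.card sing.range *
          Nat.card ((C' (cond n)).map (galoisCohomology.localization
            ((W.baseChange K).torsionGaloisModule ((p ^ k : ℕ) : ℤ)) (Sum.inr (lam ℓ)) 1)) = p ^ k) := by
    intro n ℓ
    by_cases hℓ : ℓ ∈ n
    · exact ⟨PUnit, inferInstance, 0, fun h ↦ absurd hℓ h⟩
    · obtain ⟨Sg, inst, sing, h1, h2⟩ := hdual_ℓ (cond n) ℓ (hadm n).1 (hadm n).2.1 (hadmk n) ℓ.2.1
        (hPk ℓ) ((hadm n).2.2.2 ℓ hℓ) (lam ℓ) (hlam_mem ℓ)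
      exact ⟨Sg, inst, sing, fun _ ↦ ⟨h1, h2⟩⟩
  choose Sg instSg sing hsing_all using hdl
  letI : ∀ n, AddCommGroup (Qg n) := instQ
  letI : ∀ n, AddCommGroup (Qg' n) := instQ'
  haveI : ∀ n, Finite (Qg' n) := instFin
  letI : ∀ n ℓ, AddCommGroup (Sg n ℓ) := instSg
  -- ### the abstract walk, instantiated
  have key := JET.Section6.tamagawaExponent_le_m_of_selmerFamilies (P := P) hp htk
    (loc := fun ℓ ↦ galoisCohomology.localization
      ((W.baseChange K).torsionGaloisModule ((p ^ k : ℕ) : ℤ)) (Sum.inr (lam ℓ)) 1)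
    (Hf := fun ℓ _ ↦ (W.baseChange K).kummerSelmerStructure ((p ^ k : ℕ) : ℤ) (Sum.inr (lam ℓ)))
    (Htr := fun ℓ _ ↦ 𝒯 (Sum.inr (lam ℓ)))
    ?hdisj
    (Gs := fun s ↦ signPart W K τ ((p ^ k : ℕ) : ℤ) (if s then 1 else -1) ⊤)
    (Sel := fun n s ↦ signPart W K τ ((p ^ k : ℕ) : ℤ) (if s then 1 else -1)
      (selmerF W ((p ^ k : ℕ) : ℤ) 𝒯 (placesDividing K (cond n))).selmerGroup)
    (Rel := fun n ℓ s ↦ signPart W K τ ((p ^ k : ℕ) : ℤ) (if s then 1 else -1)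
      ((selmerF W ((p ^ k : ℕ) : ℤ) 𝒯 (placesDividing K (cond n))).relaxedAt {lam ℓ}).selmerGroup)
    ?hSelGs ?hfin ?hSel ?hSelT ?hPT
    (e := fun n ↦ eb (cond n)) ?he ?h61
    (M := fun n ↦ Zhang2014.levelIndex W p (cond n))
    (mdiv := fun n ↦ divOrd (D (cond n)) p)
    (mc := fun n ↦ if divOrd (D (cond n)) p < Zhang2014.levelIndex W p (cond n)
      then divOrd (D (cond n)) p else ⊤)
    ?hm ?hM
    (κ := fun n ↦ ((D (cond n)).kolyvaginClass hp k :
      galoisCohomology ((W.baseChange K).torsionGaloisModule ((p ^ k : ℕ) : ℤ)) 1))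
    (κt := fun n ↦ if h : (if divOrd (D (cond n)) p < Zhang2014.levelIndex W p (cond n)
        then divOrd (D (cond n)) p else (⊤ : ℕ∞)) + (k : ℕ∞) ≤ Zhang2014.levelIndex W p (cond n)
      then Classical.choose (hκt (cond n) (hadm n).1 (hadm n).2.1 (hadmk n) h) else 0)
    ?hκt ?hordκ ?h47 ?h0
    (B' := fun n ↦ signPart W K τ ((p ^ k : ℕ) : ℤ) (if !eb (cond n) then 1 else -1)
      (selmerF0 W ((p ^ k : ℕ) : ℤ) 𝒯 𝒮 (placesDividing K (cond n)) Qcar).selmerGroup)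
    (C' := fun n ↦ C' (cond n)) ?hB' ?hC'Gs
    (Q := Qg) (Q' := Qg') (locq := locq) (locq' := locq') hker horth_q hQcyc hQcard
    (D' := fun n ℓ ↦ signPart W K τ ((p ^ k : ℕ) : ℤ) (if !eb (cond n) then 1 else -1)
      (((selmerF0 W ((p ^ k : ℕ) : ℤ) 𝒯 𝒮 (placesDividing K (cond n)) Qcar).relaxedAt
        {lam ℓ}).selmerGroup))
    (S := Sg) (sing := sing) ?hsing ?horthl ?h49
  · -- read the conclusion at the empty conductor `cond ∅ = c`
    beta_reduce at key
    rwa [hcond_empty] at key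
  case hdisj =>
    intro ℓ s
    exact hdisj ℓ ℓ.2.1 (hPk ℓ) (lam ℓ) (hlam_mem ℓ)
  case hSelGs =>
    intro n s
    exact Walk.signPart_le_signPart_top W K τ _ _ _
  case hfin =>
    intro n ℓ s _
    haveI := hfin (cond n) (lam ℓ)
    exact Finite.of_injective _ (AddSubgroup.inclusion_injective (inf_le_left
      (a := ((selmerF W ((p ^ k : ℕ) : ℤ) 𝒯 (placesDividing K (cond n))).relaxedAt {lam ℓ}).selmerGroup)
      (b := (conjActH1 W K τ ((p ^ k : ℕ) : ℤ) - (if s then (1 : ℤ) else -1) •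
        AddMonoidHom.id _).ker)))
  case hSel =>
    intro n ℓ s hℓ
    show signPart W K τ _ _ (selmerF W _ 𝒯 (placesDividing K (cond n))).selmerGroup = _
    rw [← Walk.signPart_inf_right]
    congr 1
    exact Walk.selmerGroup_transverseAt_eq_relaxedAt_inf _ 𝒯 (hlam_not n ℓ hℓ)
  case hSelT =>
    intro n ℓ s hℓ
    show signPart W K τ _ _ (selmerF W _ 𝒯 (placesDividing K (cond (insert ℓ n)))).selmerGroup = _
    rw [hplaces_insert n ℓ hℓ, ← Walk.signPart_inf_right]
    congr 1
    exact Walk.selmerGroup_transverseAt_insert _ 𝒯 _ (lam ℓ)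
  case hPT =>
    intro n ℓ s hℓ
    exact hPT (cond n) (hadm n).1 (hadm n).2.1 (hadmk n) ℓ ℓ.2.1 (hPk ℓ) ((hadm n).2.2.2 ℓ hℓ)
      (lam ℓ) (hlam_mem ℓ) s
  case he =>
    intro n ℓ hℓ
    rw [hcond_insert n ℓ hℓ]
    exact heb (cond n) ℓ (hPprime ℓ) ((hadm n).2.2.2 ℓ hℓ)
  case h61 =>
    intro s x y hx hy hy0 n
    rw [Walk.mem_signPart_top_iff] at hx hy
    have hes : ((if s then (1 : ℤ) else -1) = 1 ∨ (if s then (1 : ℤ) else -1) = -1) := by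
      cases s <;> simp
    have hy' : conjAct W τ ((p ^ k : ℕ) : ℤ) y = (-(if s then (1 : ℤ) else -1)) • y := by
      rw [hy]; cases s <;> simp
    obtain ⟨ℓ₀, hℓS, hℓc, hZ, hidx, hord⟩ :=
      Walk.exists_fresh_kolyvaginPrime_addOrderOf_localization_eq W hK hp2 hρ τ hτ hk u hes x y hx hy'
        hy0 (n.image fun ℓ : P ↦ (ℓ : ℕ)) hc0
    refine ⟨⟨ℓ₀, hZ, hidx, hℓc⟩, fun hmem ↦ hℓS (Finset.mem_image_of_mem _ hmem), ?_⟩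
    exact hord (lam ⟨ℓ₀, hZ, hidx, hℓc⟩) (hlam_mem _)
  case hm =>
    intro n h
    rw [if_pos h]
  case hM =>
    intro n
    rw [hcond_empty]
    exact hMn n
  case hκt =>
    intro n h
    simp only [dif_pos h]
    exact Classical.choose_spec (hκt (cond n) (hadm n).1 (hadm n).2.1 (hadmk n) h)
  case hordκ =>
    intro n j hj hdvd
    exact hordκ (cond n) (hadm n).1 (hadm n).2.1 (hadmk n) j hj hdvd
  case h47 =>
    intro n ℓ hℓ
    rw [hcond_insert n ℓ hℓ]
    have hsq : Squarefree (cond n * ℓ) := by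
      rw [← hcond_insert n ℓ hℓ]; exact (hadm (insert ℓ n)).2.1
    have hK' : ∀ l' ∈ (cond n * (ℓ : ℕ)).primeFactors,
        Zhang2014.IsKolyvaginPrime (W.conductorNorm ℤ) W K p l' ∧ k ≤ Zhang2014.kolyvaginIndex W p l' := by
      rw [← hcond_insert n ℓ hℓ]; exact hadmk (insert ℓ n)
    obtain ⟨hσ, hS1, hS2, hemb⟩ := hdata (cond n) ℓ (hadm n).1 hsq (hPprime ℓ) ((hadm n).2.2.2 ℓ hℓ)
    exact JET.addOrderOf_localization_kolyvaginClass_mul_eq_of_prop44 h44 W hcm K hK hD3 hD4 hH p hp2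
      htower Dt β ι k hk (cond n) ℓ hsq (hPprime ℓ) ((hadm n).2.2.2 ℓ hℓ) hK' (D (cond n))
      (D (cond n * ℓ)) hσ hS1 hS2 hemb (lam ℓ) (hlam_mem ℓ)
  case h0 =>
    rw [hcond_empty]
    exact h0
  case hB' =>
    intro n
    exact signPart_mono W K τ _ _ (Walk.selmerGroup_selmerF0_le W _ 𝒯 𝒮 hS (hQnot n))
  case hC'Gs =>
    intro n
    exact hC (cond n)
  case hsing =>
    intro n ℓ x hℓ
    exact (hsing_all n ℓ hℓ).1 x
  case horthl =>
    intro n ℓ hℓ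
    exact (hsing_all n ℓ hℓ).2
  case h49 =>
    intro n ℓ hℓ
    rw [hcond_insert n ℓ hℓ]
    exact h49 (cond n) ℓ (hadm n).1 (hadm n).2.1 (hadmk n) ℓ.2.1 (hPk ℓ) ((hadm n).2.2.2 ℓ hℓ)
      (lam ℓ) (hlam_mem ℓ)

end Summit.BirchSwinnertonDyer.Rank1Residual.X11b.Three.Koly

end
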